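import Literature.NumberTheory.Sieve.IwaniecAlmostPrimesHolds
import Literature.NumberTheory.Sieve.IwaniecAlmostPrimesWeightedSum
import Summits.Parity.BatemanHorn.Theorems.SoloInformedUpperBoundSieve
import Summits.Parity.BatemanHorn.Theorems.SoloInformedLargeDivisorTiers

/-!
# The upper-bound wall at Iwaniec's level `x^{16/15}`: `π_E(N) ≤ (15𝔖/8 + δ) N / log N`

Solo unit `solo-Parity-informed` (ideation tier, informed mode), session 10; `PLAN.md` §18, CLAIMS C47.

`SoloInformedUpperBoundSieve` certifies the classical wall `π_E(N) ≤ (2𝔖 + o(1)) N/log N`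
(`4 ×` Conjecture E) from the linear sieve at the trivial level of distribution `N^{1-ε}` of
`{n² + 1 : n ≤ N}`.  The deepest proved input about this sequence in the tree is Iwaniec's
bilinear form of the remainder term (Invent. Math. 47 (1978), Lemma 2 = Acta Arith. 37 (1980)
Thm 1, and Proposition 1, the dispersion estimate resting on Hooley's bound for incomplete
Kloosterman sums), which raises the level to `N^{16/15-ε}` for the linear-sieve weights:
`Iwaniec1978.proposition2_upper_holds` (PROVED in `Literature`).  Specialised to the single class
`q = 1` with `z = N^{2/5}` (so `s = (16/15)/(2/5) = 8/3 ≤ 3`, `F(s) = 2e^γ/s`) it gives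

* `eventually_nSqAddOnePrimeCount_le_iwaniec` — **`π_E(N) ≤ (15𝔖/8 + δ) N / log N` eventually**,
  i.e. `3.75 ×` Conjecture E's `𝔖 N/(2 log N)` (level `N^θ` gives the factor `4/θ`; the parity
  wall of Bombieri's asymptotic sieve is `θ = 2`, factor `2`);

and, through `ψ ≤ 2 (sup π_E log N / N) N + o(N)` and `ψ = 𝔖 N + E - T`
(`eventually_sum_vonMangoldt_le_of_primeCount`, `eventually_neg_le_largeDivisorSum_of_primeCount`,
stated for an arbitrary certified constant `K`),

* `eventually_sum_vonMangoldt_sq_add_one_le_iwaniec` — `ψ(N) ≤ (15𝔖/4 + δ) N` eventually;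
* `eventually_neg_le_largeDivisorSum_iwaniec` — `-(11𝔖/4 + δ) N ≤ T(N)` eventually
  (`T(N) = ∑_{n ≤ N} ∑_{d ∣ n²+1, d > ⌊N^{1-ε}⌋} μ(d) log d`; Conjecture E is `T = o(N)`).

References: H. Iwaniec, *Almost-primes represented by quadratic polynomials*, Invent. Math. 47
(1978) 171–188, Prop. 2 p. 185 [IwaniecInventiones1978]; H. Iwaniec, *A new form of the error term
in the linear sieve*, Acta Arith. 37 (1980) 307–320 [IwaniecActaArith1980b]; E. Bombieri, *The
asymptotic sieve*, Rend. Accad. Naz. XL (5) 1/2 (1975/76) 243–269.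
-/

namespace Summit.Parity.BatemanHorn.Theorems

open Finset Filter ArithmeticFunction Asymptotics
open scoped ArithmeticFunction.Moebius Topology
open Literature.NumberTheory.Sieve (hardyLittlewoodEConst hardyLittlewoodEConst_pos
  nSqAddOnePrimeCount primesProdBelow dvd_primesProdBelow_iff)
open Literature.NumberTheory.Sieve.Iwaniec1978 (rho rho_one siftedCount densityProd densityProd_pos
  IsLinearSieveFunctions exists_isLinearSieveFunctions proposition2_upper_holds)

/-! ### `π_E` against a sifted count -/

/-- `π_E(N) ≤ #{1 ≤ n ≤ N : (n² + 1, P(z)) = 1} + z` (`z ≥ 0`): a prime `n² + 1` is either coprime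
to `P(z) = ∏_{p<z} p` or itself `< z`, whence `n < z`. -/
theorem nSqAddOnePrimeCount_le_card_coprime_add (N : ℕ) {z : ℝ} (hz0 : 0 ≤ z) :
    (nSqAddOnePrimeCount N : ℝ) ≤
      #((Icc 1 N).filter fun n : ℕ => (n ^ 2 + 1).Coprime (primesProdBelow z)) + z := by
  have hsub : (Icc 1 N).filter (fun n : ℕ => (n ^ 2 + 1).Prime) ⊆
      (Icc 1 N).filter (fun n : ℕ => (n ^ 2 + 1).Coprime (primesProdBelow z)) ∪ Icc 1 ⌊z⌋₊ := by
    intro n hn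
    rw [mem_filter] at hn
    rw [mem_union]
    by_cases hc : (n ^ 2 + 1).Coprime (primesProdBelow z)
    · exact Or.inl (mem_filter.mpr ⟨hn.1, hc⟩)
    · refine Or.inr (mem_Icc.mpr ?_)
      have hdvd : (n ^ 2 + 1) ∣ primesProdBelow z := by
        by_contra hnd
        exact hc ((Nat.Prime.coprime_iff_not_dvd hn.2).mpr hnd)
      have hlt : ((n ^ 2 + 1 : ℕ) : ℝ) < z := (dvd_primesProdBelow_iff hn.2 z).mp hdvd
      refine ⟨(mem_Icc.mp hn.1).1, Nat.le_floor ?_⟩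
      have h1 : (n : ℝ) ≤ (n : ℝ) ^ 2 + 1 := by nlinarith [sq_nonneg ((n : ℝ) - 1)]
      push_cast at hlt
      linarith
  calc (nSqAddOnePrimeCount N : ℝ)
      = #((Icc 1 N).filter fun n : ℕ => (n ^ 2 + 1).Prime) := by rfl
    _ ≤ #((Icc 1 N).filter (fun n : ℕ => (n ^ 2 + 1).Coprime (primesProdBelow z)) ∪
          Icc 1 ⌊z⌋₊) := by
        exact_mod_cast card_le_card hsub
    _ ≤ #((Icc 1 N).filter fun n : ℕ => (n ^ 2 + 1).Coprime (primesProdBelow z))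
          + #(Icc 1 ⌊z⌋₊) := by
        exact_mod_cast card_union_le _ _
    _ = #((Icc 1 N).filter fun n : ℕ => (n ^ 2 + 1).Coprime (primesProdBelow z)) + ⌊z⌋₊ := by
        rw [Nat.card_Icc, Nat.add_sub_cancel]
    _ ≤ _ := by gcongr; exact Nat.floor_le hz0

/-- Iwaniec's `S(𝒜; u)` (the class `q = 1`) at `x = N` is the coprime count. -/
theorem siftedCount_natCast_one (N : ℕ) (u : ℝ) :
    siftedCount (N : ℝ) 1 u =
      #((Icc 1 N).filter fun n : ℕ => (n ^ 2 + 1).Coprime (primesProdBelow u)) := by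
  unfold siftedCount
  rw [Nat.floor_natCast]
  congr 1
  exact filter_congr fun n _ => by simp only [one_dvd, true_and]

/-! ### Iwaniec's Proposition 2 at `q = 1`, `z = N^{2/5}` -/

/-- **`S(𝒜; N^{2/5}) ≤ V(N^{2/5}) N (¾ e^γ + C ε)` for all large `N`**, for every `0 < ε < 1`, with
one constant `C` (Iwaniec's `O_γ(ε)` at `γ = 2/5`): `proposition2_upper_holds` with the single class
`q = 1`, `z_q = N^{2/5}`, and `F(8/3) = ¾ e^γ`. -/
theorem siftedCount_le_iwaniec :
    ∃ C : ℝ, ∀ ε : ℝ, 0 < ε → ε < 1 → ∀ᶠ N : ℕ in atTop,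
      (siftedCount (N : ℝ) 1 ((N : ℝ) ^ (2 / 5 : ℝ)) : ℝ) ≤
        densityProd ((N : ℝ) ^ (2 / 5 : ℝ)) * N *
          (3 / 4 * Real.exp Real.eulerMascheroniConstant + C * ε) := by
  obtain ⟨F, f, hFf⟩ := exists_isLinearSieveFunctions
  obtain ⟨Cγ, hCγ⟩ := proposition2_upper_holds F f hFf (2 / 5) (by norm_num) (by norm_num)
  refine ⟨Cγ, fun ε hε hε1 => ?_⟩
  obtain ⟨x₀, hx₀⟩ := hCγ ε hε
  have hF : F (8 / 3) = 3 / 4 * Real.exp Real.eulerMascheroniConstant := by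
    have := hFf.upper_eq (8 / 3) (by norm_num) (by norm_num)
    linarith
  filter_upwards [tendsto_natCast_atTop_atTop.eventually_ge_atTop x₀, eventually_ge_atTop 2]
    with N hN hN2
  have hN' : (2 : ℝ) ≤ N := by exact_mod_cast hN2
  have hN1 : (1 : ℝ) < N := by linarith
  have hN0 : (0 : ℝ) < N := by linarith
  have h := hx₀ N hN (fun _ => (N : ℝ) ^ (2 / 5 : ℝ)) (fun q => if q = 1 then 1 else 0)
    (fun _ => ⟨le_rfl, Real.rpow_lt_rpow_of_exponent_lt hN1 (by norm_num)⟩)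
    (fun q => by split_ifs <;> norm_num)
  simp only at h
  have h1Q : (1 : ℕ) ∈ (Ico 1 ⌈(N : ℝ) ^ (1 - ε)⌉₊).filter
      (fun q : ℕ => q.Coprime (primesProdBelow ((N : ℝ) ^ (2 / 5 : ℝ)))) := by
    refine mem_filter.mpr ⟨mem_Ico.mpr ⟨le_rfl, Nat.lt_ceil.mpr ?_⟩, Nat.coprime_one_left _⟩
    rw [Nat.cast_one]
    exact Real.one_lt_rpow hN1 (by linarith)
  rw [sum_eq_single_of_mem 1 h1Q (fun q _ hq => by simp [hq]),
    sum_eq_single_of_mem 1 h1Q (fun q _ hq => by simp [hq])] at h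
  simp only [if_true, one_mul, rho_one, Nat.cast_one, div_one] at h
  have hlogne : Real.log N ≠ 0 := (Real.log_pos hN1).ne'
  have hs : Real.log ((N : ℝ) ^ (16 / 15 : ℝ)) / Real.log ((N : ℝ) ^ (2 / 5 : ℝ)) = 8 / 3 := by
    rw [Real.log_rpow hN0, Real.log_rpow hN0, mul_div_mul_right _ _ hlogne]; norm_num
  have hself : Real.log ((N : ℝ) ^ (2 / 5 : ℝ)) / Real.log ((N : ℝ) ^ (2 / 5 : ℝ)) = 1 := by
    rw [Real.log_rpow hN0]
    exact div_self (mul_ne_zero (by norm_num) hlogne)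
  rw [hs, hself, mul_one, hF] at h
  exact h

/-! ### `π_E(N) ≤ (15𝔖/8 + δ) N / log N` -/

/-- **The upper bound at Iwaniec's level `N^{16/15}`**: for every `δ > 0`,
`π_E(N) ≤ (15𝔖/8 + δ) N / log N` for all large `N` — `3.75 ×` Conjecture E
(`Iwaniec1978.proposition2_upper_holds` at `q = 1`, `z = N^{2/5}`, with the Bateman–Horn Mertens
product `log N · V(N^{2/5}) → (5/2) 𝔖 e^{-γ}`). -/
theorem eventually_nSqAddOnePrimeCount_le_iwaniec {δ : ℝ} (hδ : 0 < δ) :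
    ∀ᶠ N : ℕ in atTop,
      (nSqAddOnePrimeCount N : ℝ) ≤ (15 / 8 * hardyLittlewoodEConst + δ) * N / Real.log N := by
  have hS := hardyLittlewoodEConst_pos
  obtain ⟨C, hC⟩ := siftedCount_le_iwaniec
  have hEγ : Real.exp (-Real.eulerMascheroniConstant) * Real.exp Real.eulerMascheroniConstant
      = 1 := by
    rw [← Real.exp_add, neg_add_cancel, Real.exp_zero]
  -- `A` = the Mertens limit, `ε` with `A |C| ε ≤ δ/4`, `η` with `η B ≤ δ/4`
  obtain ⟨A, hAdef⟩ : ∃ A : ℝ,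
      A = hardyLittlewoodEConst * Real.exp (-Real.eulerMascheroniConstant) * (2 / 5 : ℝ)⁻¹ :=
    ⟨_, rfl⟩
  have hA : 0 < A := by rw [hAdef]; positivity
  have hAmain : A * (3 / 4 * Real.exp Real.eulerMascheroniConstant) =
      15 / 8 * hardyLittlewoodEConst := by
    rw [hAdef]
    have : hardyLittlewoodEConst * Real.exp (-Real.eulerMascheroniConstant) * (2 / 5 : ℝ)⁻¹ *
        (3 / 4 * Real.exp Real.eulerMascheroniConstant) = 15 / 8 * hardyLittlewoodEConst *
          (Real.exp (-Real.eulerMascheroniConstant) * Real.exp Real.eulerMascheroniConstant) := by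
      ring
    rw [this, hEγ, mul_one]
  obtain ⟨ε, hεdef⟩ : ∃ ε : ℝ, ε = min (1 / 2) (δ / (4 * (A * |C| + 1))) := ⟨_, rfl⟩
  have hε : 0 < ε := by rw [hεdef]; exact lt_min (by norm_num) (by positivity)
  have hε1 : ε < 1 := by rw [hεdef]; exact (min_le_left _ _).trans_lt (by norm_num)
  have hεC : A * |C| * ε ≤ δ / 4 := by
    have h1 : ε ≤ δ / (4 * (A * |C| + 1)) := by rw [hεdef]; exact min_le_right _ _
    have h2 : 0 ≤ A * |C| := by positivity
    calc A * |C| * ε ≤ A * |C| * (δ / (4 * (A * |C| + 1))) := by gcongr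
      _ = δ / 4 * (A * |C| / (A * |C| + 1)) := by field_simp
      _ ≤ δ / 4 * 1 := by gcongr; rw [div_le_one (by positivity)]; linarith
      _ = δ / 4 := mul_one _
  obtain ⟨B, hBdef⟩ : ∃ B : ℝ, B = 3 / 4 * Real.exp Real.eulerMascheroniConstant + |C| * ε :=
    ⟨_, rfl⟩
  have hB : 0 < B := by rw [hBdef]; positivity
  obtain ⟨η, hηdef⟩ : ∃ η : ℝ, η = δ / (4 * B) := ⟨_, rfl⟩
  have hη : 0 < η := by rw [hηdef]; positivity
  have hηB : η * B = δ / 4 := by rw [hηdef]; field_simp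
  -- eventual inputs
  have hVle : ∀ᶠ N : ℕ in atTop, Real.log N *
      ∏ p ∈ Nat.primesBelow ⌈(N : ℝ) ^ (2 / 5 : ℝ)⌉₊, (1 - (rho p : ℝ) / p) ≤ A + η := by
    have h := tendsto_log_mul_prod_one_sub_rho_div (by norm_num : (0 : ℝ) < 2 / 5)
    rw [← hAdef] at h
    exact h.eventually_le_const (by linarith)
  have hlog : ∀ᶠ N : ℕ in atTop, Real.log N ≤ δ / 2 * (N : ℝ) ^ (3 / 5 : ℝ) := by
    have h := (isLittleO_log_rpow_atTop (by norm_num : (0 : ℝ) < 3 / 5)).bound (half_pos hδ)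
    filter_upwards [tendsto_natCast_atTop_atTop.eventually h, eventually_ge_atTop 1] with N hN hN1
    have hN' : (1 : ℝ) ≤ N := by exact_mod_cast hN1
    rwa [Real.norm_of_nonneg (Real.log_nonneg hN'),
      Real.norm_of_nonneg (Real.rpow_nonneg (by linarith) _)] at hN
  filter_upwards [hC ε hε hε1, hVle, hlog, eventually_ge_atTop 2] with N hSN hVN hlogN hN2
  have hN : (2 : ℝ) ≤ N := by exact_mod_cast hN2
  have hN0 : (0 : ℝ) < N := by linarith
  have hlog0 : 0 < Real.log N := Real.log_pos (by linarith)
  have hz0 : (0 : ℝ) ≤ (N : ℝ) ^ (2 / 5 : ℝ) := Real.rpow_nonneg hN0.le _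
  have hπ := nSqAddOnePrimeCount_le_card_coprime_add N hz0
  rw [← siftedCount_natCast_one] at hπ
  -- `hπ : π ≤ S + N^{2/5}`, `hSN : S ≤ V N (¾e^γ + C ε)`, `hVN : log N · V ≤ A + η`
  have hV0 : 0 ≤ densityProd ((N : ℝ) ^ (2 / 5 : ℝ)) * N :=
    mul_nonneg (densityProd_pos _).le hN0.le
  have hSB : (siftedCount (N : ℝ) 1 ((N : ℝ) ^ (2 / 5 : ℝ)) : ℝ) ≤
      densityProd ((N : ℝ) ^ (2 / 5 : ℝ)) * N * B := by
    refine hSN.trans (mul_le_mul_of_nonneg_left ?_ hV0)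
    rw [hBdef]
    have : C * ε ≤ |C| * ε := mul_le_mul_of_nonneg_right (le_abs_self C) hε.le
    linarith
  have hVN' : Real.log N * densityProd ((N : ℝ) ^ (2 / 5 : ℝ)) ≤ A + η := hVN
  have hAB : (A + η) * B ≤ 15 / 8 * hardyLittlewoodEConst + δ / 2 := by
    have h1 : (A + η) * B = A * (3 / 4 * Real.exp Real.eulerMascheroniConstant)
        + A * |C| * ε + η * B := by rw [hBdef]; ring
    rw [h1, hAmain, hηB]
    linarith
  have hsplit : (N : ℝ) ^ (2 / 5 : ℝ) * (N : ℝ) ^ (3 / 5 : ℝ) = N := by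
    rw [← Real.rpow_add hN0]; norm_num
  rw [le_div_iff₀ hlog0]
  calc (nSqAddOnePrimeCount N : ℝ) * Real.log N
      ≤ (densityProd ((N : ℝ) ^ (2 / 5 : ℝ)) * N * B + (N : ℝ) ^ (2 / 5 : ℝ)) * Real.log N :=
        mul_le_mul_of_nonneg_right (hπ.trans (by linarith)) hlog0.le
    _ = (Real.log N * densityProd ((N : ℝ) ^ (2 / 5 : ℝ))) * B * N
          + (N : ℝ) ^ (2 / 5 : ℝ) * Real.log N := by ring
    _ ≤ (A + η) * B * N + (N : ℝ) ^ (2 / 5 : ℝ) * (δ / 2 * (N : ℝ) ^ (3 / 5 : ℝ)) := by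
        gcongr
    _ = (A + η) * B * N + δ / 2 * N := by
        rw [mul_left_comm ((N : ℝ) ^ (2 / 5 : ℝ)) (δ / 2), hsplit]
    _ ≤ (15 / 8 * hardyLittlewoodEConst + δ / 2) * N + δ / 2 * N := by gcongr
    _ = (15 / 8 * hardyLittlewoodEConst + δ) * N := by ring

/-! ### From a certified `π_E` constant to `ψ` and to the lower wall for `T` -/

/-- If `π_E(N) ≤ (K + δ) N/log N` eventually for every `δ > 0`, then
`ψ(N) = ∑_{n ≤ N} Λ(n²+1) ≤ (2K + δ) N` eventually for every `δ > 0`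
(`θ ≤ π_E log(N²+1) ≤ π_E (2 log N + 1)`, `ψ - θ = o(N)`). -/
theorem eventually_sum_vonMangoldt_le_of_primeCount {K : ℝ} (hK : 0 ≤ K)
    (h : ∀ δ : ℝ, 0 < δ →
      ∀ᶠ N : ℕ in atTop, (nSqAddOnePrimeCount N : ℝ) ≤ (K + δ) * N / Real.log N)
    {δ : ℝ} (hδ : 0 < δ) :
    ∀ᶠ N : ℕ in atTop, ∑ n ∈ Icc 1 N, Λ (n ^ 2 + 1) ≤ (2 * K + δ) * N := by
  have hδ8 : (0 : ℝ) < δ / 8 := by positivity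
  have hlogbig : ∀ᶠ N : ℕ in atTop, (K + δ / 8) * 8 / δ ≤ Real.log N :=
    (Real.tendsto_log_atTop.comp tendsto_natCast_atTop_atTop).eventually_ge_atTop _
  filter_upwards [h _ hδ8, eventually_properPrimePow_sum_le hδ8, hlogbig, eventually_ge_atTop 2]
    with N hπ hPP hlogN hN2
  have hN : (2 : ℝ) ≤ N := by exact_mod_cast hN2
  have hlog0 : 0 < Real.log N := Real.log_pos (by linarith)
  rw [sum_vonMangoldt_eq_theta_add]
  have hl2 : Real.log ((N : ℝ) ^ 2 + 1) ≤ 2 * Real.log N + 1 := log_sq_add_one_le (by linarith)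
  have hπ' : (nSqAddOnePrimeCount N : ℝ) * Real.log N ≤ (K + δ / 8) * N :=
    (le_div_iff₀ hlog0).mp hπ
  have hπ0 : (0 : ℝ) ≤ nSqAddOnePrimeCount N := Nat.cast_nonneg _
  have hπ1 : (nSqAddOnePrimeCount N : ℝ) ≤ δ / 8 * N := by
    have h1 : (nSqAddOnePrimeCount N : ℝ) * Real.log N ≤ (δ / 8 * N) * Real.log N :=
      calc (nSqAddOnePrimeCount N : ℝ) * Real.log N
          ≤ (K + δ / 8) * N := hπ'
        _ = (δ / 8 * N) * ((K + δ / 8) * 8 / δ) := by field_simp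
        _ ≤ (δ / 8 * N) * Real.log N := by gcongr
    exact le_of_mul_le_mul_right h1 hlog0
  have hθ' : ∑ n ∈ (Icc 1 N).filter (fun n : ℕ => Nat.Prime (n ^ 2 + 1)),
        Real.log ((n ^ 2 + 1 : ℕ) : ℝ)
      ≤ 2 * ((K + δ / 8) * N) + δ / 8 * N :=
    calc _ ≤ (nSqAddOnePrimeCount N : ℝ) * Real.log ((N : ℝ) ^ 2 + 1) := theta_le_card_mul_log N
      _ ≤ (nSqAddOnePrimeCount N : ℝ) * (2 * Real.log N + 1) := mul_le_mul_of_nonneg_left hl2 hπ0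
      _ = 2 * ((nSqAddOnePrimeCount N : ℝ) * Real.log N) + nSqAddOnePrimeCount N := by ring
      _ ≤ 2 * ((K + δ / 8) * N) + δ / 8 * N := by gcongr
  have : 0 ≤ δ * N := by positivity
  linarith

/-- If `π_E(N) ≤ (K + δ) N/log N` eventually for every `δ > 0`, then for `0 < ε < 1` and `δ > 0`
eventually `-(2K - 𝔖 + δ) N ≤ T(N)` (`ψ = 𝔖 N + E - T`, `E = o(N)`:
`sum_vonMangoldt_eq_main_sub_largeDivisorSum`, `eventually_abs_mainError_le`). -/
theorem eventually_neg_le_largeDivisorSum_of_primeCount {K : ℝ} (hK : 0 ≤ K)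
    (h : ∀ δ : ℝ, 0 < δ →
      ∀ᶠ N : ℕ in atTop, (nSqAddOnePrimeCount N : ℝ) ≤ (K + δ) * N / Real.log N)
    {ε : ℝ} (hε : 0 < ε) (hε1 : ε < 1) {δ : ℝ} (hδ : 0 < δ) :
    ∀ᶠ x : ℕ in atTop,
      -((2 * K - hardyLittlewoodEConst + δ) * x) ≤
        ∑ n ∈ Icc 1 x, ∑ e ∈ (n ^ 2 + 1).divisors with ⌊(x : ℝ) ^ (1 - ε)⌋₊ < (n ^ 2 + 1) / e,
          (μ ((n ^ 2 + 1) / e) : ℝ) * Real.log (((n ^ 2 + 1) / e : ℕ) : ℝ) := by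
  filter_upwards [eventually_sum_vonMangoldt_le_of_primeCount hK h (half_pos hδ),
    eventually_abs_mainError_le hε hε1 (half_pos hδ)] with x hψ hE
  have hid := sum_vonMangoldt_eq_main_sub_largeDivisorSum x ε
  have := (abs_le.mp hE).1
  linarith

/-- **`ψ(N) ≤ (15𝔖/4 + δ) N` eventually** (Iwaniec's level). -/
theorem eventually_sum_vonMangoldt_sq_add_one_le_iwaniec {δ : ℝ} (hδ : 0 < δ) :
    ∀ᶠ N : ℕ in atTop,
      ∑ n ∈ Icc 1 N, Λ (n ^ 2 + 1) ≤ (15 / 4 * hardyLittlewoodEConst + δ) * N := by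
  have h := eventually_sum_vonMangoldt_le_of_primeCount
    (by have := hardyLittlewoodEConst_pos; positivity : (0 : ℝ) ≤ 15 / 8 * hardyLittlewoodEConst)
    (fun δ hδ => eventually_nSqAddOnePrimeCount_le_iwaniec hδ) hδ
  convert h using 4; ring

/-- **`-(11𝔖/4 + δ) N ≤ T(N)` eventually** (Iwaniec's level), for `0 < ε < 1`, `δ > 0`: the
kernel's lower wall for the large-divisor Möbius–log sum of `n² + 1`; the upper wall is
`T(N) ≤ (𝔖 + δ) N` (`eventually_largeDivisorSum_le`), Conjecture E is `T = o(N)`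
(`hardyLittlewoodConjE_iff_largeDivisorSum_twoSided`), and level `N^{2-ε}` (parity) would be
`-(𝔖 + δ) N`. -/
theorem eventually_neg_le_largeDivisorSum_iwaniec {ε : ℝ} (hε : 0 < ε) (hε1 : ε < 1) {δ : ℝ}
    (hδ : 0 < δ) :
    ∀ᶠ x : ℕ in atTop,
      -((11 / 4 * hardyLittlewoodEConst + δ) * x) ≤
        ∑ n ∈ Icc 1 x, ∑ e ∈ (n ^ 2 + 1).divisors with ⌊(x : ℝ) ^ (1 - ε)⌋₊ < (n ^ 2 + 1) / e,
          (μ ((n ^ 2 + 1) / e) : ℝ) * Real.log (((n ^ 2 + 1) / e : ℕ) : ℝ) := by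
  have h := eventually_neg_le_largeDivisorSum_of_primeCount
    (by have := hardyLittlewoodEConst_pos; positivity : (0 : ℝ) ≤ 15 / 8 * hardyLittlewoodEConst)
    (fun δ hδ => eventually_nSqAddOnePrimeCount_le_iwaniec hδ) hε hε1 hδ
  convert h using 5; ring

end Summit.Parity.BatemanHorn.Theorems
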